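import Literature.AlgebraicGeometry.HodgeTheory.SupportedHodgeClassDescent
import Literature.AlgebraicGeometry.HodgeTheory.HypersurfaceComplexPoints
import Literature.AlgebraicGeometry.HodgeTheory.LefschetzOneOneChowClosed
import Literature.AlgebraicGeometry.HodgeTheory.IsoTransport
import Literature.AlgebraicGeometry.Motives.ComplexPointsEhresmann
import Literature.AlgebraicGeometry.Resolution.ProjectiveResolutionProofs

/-!
# Route AmpleAdicLefschetz — `AlgebraicClassesHodgeType`, part 4: a resolution of an irreducible
# closed subvariety and its complex-analytic structure over the isomorphism locus

Helper file for item stmt-HodgeConjecture-15189 (`AlgebraicClassesHodgeType`).  For `X` smooth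
projective of dimension `n` over `ℂ` and `V ⊆ X` Zariski-closed irreducible with generic point `η`
of codimension `p`, `exists_resolution_isEmbedding` provides a smooth projective `Y` of dimension
`d = n - p`, a morphism `g : Y ⟶ X` with `g(Y) = V`, and a Zariski-open `O ∋ η` of `X` over which
`g(ℂ)` is a homeomorphism from `g(ℂ)⁻¹(O(ℂ))` onto `V(ℂ) ∩ O(ℂ)` — the input of the bump class of
part 2.  Construction: the reduced structure on `V` (`Motives.ClosedSubvariety.ofPoint`, an integral
projective variety), Hironaka's theorem in projective form
(`Resolution.Hironaka1964_projective_holds`), the dense open of `V` over which the resolution is an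
isomorphism, and the point-set topology of complex points (open immersions, isomorphisms and closed
immersions induce open embeddings, homeomorphisms and embeddings: `AlgPoints.isOpenEmbedding_map_holds`,
`AlgPoints.isHomeomorph_map_of_iso`, `AlgPoints.isEmbedding_map_of_isClosedImmersion`).
Everything here is proved; no definitions, no named facts.
-/

set_option linter.dupNamespace false

noncomputable section

open CategoryTheory CategoryTheory.Limits AlgebraicGeometry Set TopologicalSpace Topology
open Literature.AlgebraicGeometry Literature.AlgebraicGeometry.Motives
open Literature.AlgebraicGeometry.HodgeTheory
open Literature.AlgebraicTopology.SingularHomology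

namespace Summit.HodgeConjecture.HodgeConjecture.Theorems

variable {n : ℕ} {X : SchemeOver ℂ}

/-- **A resolution of an irreducible closed subvariety, with its complex-analytic properties.** For
`X` smooth projective of dimension `n` over `ℂ` and `V ⊆ X` Zariski-closed and irreducible with
generic point `η` of codimension `p`, there are a smooth projective `Y` of dimension `d = n - p`, a
morphism `g : Y ⟶ X` with `g(Y) = V`, and a Zariski-open `O ∋ η` of `X` such that on complex points
`g(ℂ)` restricts to a homeomorphism from `g(ℂ)⁻¹(O(ℂ))` onto `V(ℂ) ∩ O(ℂ)` (an embedding with that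
image). Construction: `V` with its reduced structure is an integral projective variety
(`Motives.ClosedSubvariety.ofPoint`), resolved by Hironaka's theorem in projective form
(`Resolution.Hironaka1964_projective_holds`: a birational `π : Y → V` from a smooth projective `Y`
of dimension `dim V = height η = n - p`); `π` is an isomorphism over a dense open `U₀ = V ∩ O` of
`V`, proper birational morphisms are onto, open immersions / isomorphisms / closed immersions
induce open embeddings / homeomorphisms / embeddings on complex points
(`AlgPoints.isOpenEmbedding_map_holds`, `AlgPoints.isHomeomorph_map_of_iso`,
`AlgPoints.isEmbedding_map_of_isClosedImmersion`). [cite: Kollar2007, Thm. 3.27]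
[cite: SGA1, Exp. XII Prop. 3.1] -/
theorem exists_resolution_isEmbedding (hX : IsSmoothProjective n X) {V : Set X.left}
    (hVc : IsClosed V) (hVi : IsIrreducible V) {p : ℕ}
    (hgen : Order.coheight hVi.genericPoint = p) :
    ∃ (d : ℕ) (Y : SchemeOver ℂ) (_ : IsSmoothProjective d Y) (g : Y ⟶ X) (O : Set X.left),
      p + d = n ∧ IsOpen O ∧ hVi.genericPoint ∈ O ∧ Set.range g.left.base = V ∧
      IsEmbedding (fun z : ↥((AlgPoints.mapContinuous (L := ℂ) g) ⁻¹'
          {P : ComplexPoints X | P.pt ∈ O}) ↦ AlgPoints.mapContinuous (L := ℂ) g z) ∧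
      (AlgPoints.mapContinuous (L := ℂ) g) '' ((AlgPoints.mapContinuous (L := ℂ) g) ⁻¹'
          {P : ComplexPoints X | P.pt ∈ O}) =
        {P : ComplexPoints X | P.pt ∈ V} ∩ {P : ComplexPoints X | P.pt ∈ O} := by
  haveI := noetherianSpace_of_isSmoothProjective hX
  -- the reduced closed subscheme structure on `V = closure {η}`
  set η := hVi.genericPoint with hη
  have hηV : closure {η} = V := hVi.closure_genericPoint hVc
  let X₀ : ClosedSubvariety X.left := ClosedSubvariety.ofPoint X.left η
  have hX₀range : Set.range X₀.ι.base = V := by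
    rw [← hηV]
    exact ClosedSubvariety.range_ofPoint_ι η
  -- Hironaka, projective form
  haveI : IsIntegral X₀.toSchemeOver.left := inferInstanceAs (IsIntegral X₀.carrier)
  obtain ⟨d, Y, π, hY, hπ, hdim⟩ := Resolution.Hironaka1964_projective_holds ℂ X₀.toSchemeOver
    (isProjectiveOver_toSchemeOver X₀ hX.isProjectiveOver)
  -- dimensions: `height η = d`, `coheight η = p`, `height + coheight = n`
  have hpd : p + d = n := by
    have h1 : Order.height η = (d : ℕ∞) := by
      have e1 : X₀.ι.base (genericPoint X₀.carrier) = η := ClosedSubvariety.genericPoint_ofPoint η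
      have e2 : Order.height (X₀.ι.base (genericPoint X₀.carrier)) =
          Order.height (genericPoint X₀.carrier) :=
        Motives.Scheme.height_base_eq_of_isClosedImmersion _ _
      rw [← e1, e2]
      exact hdim
    obtain ⟨a, c, ha, hc, hac⟩ := exists_height_eq_coheight_eq hX η
    rw [ha] at h1
    rw [hc] at hgen
    have h1' : a = d := by exact_mod_cast h1
    have h2' : c = p := by exact_mod_cast hgen
    omega
  -- the morphism `g = π ≫ (V ↪ X)`; properness of `π`, surjectivity, `g(Y) = V`
  set g : Y ⟶ X := π ≫ X₀.ιOver with hg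
  haveI : IsProper π.left := by
    haveI : IsProper Y.hom := IsSmoothProjective.isProper_holds hY
    haveI : IsProper X₀.toSchemeOver.hom := IsProjectiveOver.isProper
      (isProjectiveOver_toSchemeOver X₀ hX.isProjectiveOver)
    have h : IsProper (π.left ≫ X₀.toSchemeOver.hom) := by
      rw [Over.w π]
      infer_instance
    exact MorphismProperty.of_postcomp (W := @IsProper) (W' := @IsSeparated) π.left
      X₀.toSchemeOver.hom inferInstance h
  have hsurj := surjective_base_of_isBirational π.left hπ
  have hgrange : Set.range g.left.base = V := by
    rw [← hX₀range]
    ext v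
    constructor
    · rintro ⟨y, rfl⟩
      exact ⟨π.left.base y, rfl⟩
    · rintro ⟨x, rfl⟩
      obtain ⟨y, rfl⟩ := hsurj x
      exact ⟨y, rfl⟩
  -- the dense open `U₀ ⊆ V` over which `π` is an isomorphism, `U₀ = V ∩ O`
  obtain ⟨U₀, hU₀, -, hiso⟩ := hπ
  have hind : IsInducing X₀.ι.base := X₀.ι.isClosedEmbedding.isInducing
  obtain ⟨O, hO, hOU₀⟩ := hind.isOpen_iff.1 U₀.2
  -- `η ∈ O`: the non-empty open `U₀` of the irreducible `V` contains its generic point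
  have hηO : η ∈ O := by
    have hgen' : IsGenericPoint (genericPoint X₀.toSchemeOver.left)
        (Set.univ : Set X₀.toSchemeOver.left) := genericPoint_spec X₀.toSchemeOver.left
    have hmem : genericPoint X₀.toSchemeOver.left ∈ (U₀ : Set X₀.toSchemeOver.left) :=
      (hgen'.mem_open_set_iff U₀.2).2 (by rw [Set.univ_inter]; exact hU₀.nonempty)
    have e1 : X₀.ι.base (genericPoint X₀.carrier) = η := ClosedSubvariety.genericPoint_ofPoint η
    rw [← e1]
    have : genericPoint X₀.carrier ∈ X₀.ι.base ⁻¹' O := by rw [hOU₀]; exact hmem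
    exact this
  refine ⟨d, Y, hY, g, O, hpd, hO, hηO, hgrange, ?_⟩
  -- the open pieces: `j : π⁻¹U₀ ↪ Y`, `k₁ : π⁻¹U₀ ≅ U₀`, `k₂ : U₀ ↪ V`, `k₃ : V ↪ X`
  set W₀ : Y.left.Opens := π.left ⁻¹ᵁ U₀ with hW₀
  set j : openSubschemeOver Y W₀ ⟶ Y := openSubschemeOverι Y W₀ with hj
  set k₁ : openSubschemeOver Y W₀ ⟶ openSubschemeOver X₀.toSchemeOver U₀ := restrictOverHom π U₀
    with hk₁
  set k₂ : openSubschemeOver X₀.toSchemeOver U₀ ⟶ X₀.toSchemeOver :=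
    openSubschemeOverι X₀.toSchemeOver U₀ with hk₂
  haveI : IsOpenImmersion j.left := inferInstanceAs (IsOpenImmersion W₀.ι)
  haveI : IsOpenImmersion k₂.left := inferInstanceAs (IsOpenImmersion U₀.ι)
  haveI : IsIso (π.left ∣_ U₀) := hiso
  haveI : IsIso ((Over.forget _).map k₁) := inferInstanceAs (IsIso (π.left ∣_ U₀))
  haveI : IsIso k₁ := isIso_of_reflects_iso k₁ (Over.forget _)
  haveI : IsClosedImmersion X₀.ιOver.left := inferInstanceAs (IsClosedImmersion X₀.ι)
  have hfac : j ≫ g = k₁ ≫ k₂ ≫ X₀.ιOver := by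
    rw [hg, ← Category.assoc, ← restrictOverHom_comp_openSubschemeOverι π U₀, Category.assoc]
  -- complex points
  set gc := AlgPoints.mapContinuous (L := ℂ) g with hgc
  set jc := AlgPoints.mapContinuous (L := ℂ) j with hjc
  have hje : IsOpenEmbedding jc := AlgPoints.isOpenEmbedding_map_holds j
  have hk₁h : IsHomeomorph (AlgPoints.map (L := ℂ) k₁) := AlgPoints.isHomeomorph_map_of_iso (asIso k₁)
  have hk₂e : IsOpenEmbedding (AlgPoints.map (L := ℂ) k₂) := AlgPoints.isOpenEmbedding_map_holds k₂
  have hk₃e : IsEmbedding (AlgPoints.map (L := ℂ) X₀.ιOver) :=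
    AlgPoints.isEmbedding_map_of_isClosedImmersion X₀.ιOver
  have hcompe : IsEmbedding (fun z ↦ gc (jc z)) := by
    have h : (fun z ↦ gc (jc z)) = AlgPoints.map (L := ℂ) X₀.ιOver ∘ AlgPoints.map (L := ℂ) k₂ ∘
        AlgPoints.map (L := ℂ) k₁ := by
      funext z
      change AlgPoints.map g (AlgPoints.map j z) = _
      rw [← AlgPoints.map_comp_apply, hfac, AlgPoints.map_comp_apply, AlgPoints.map_comp_apply]
      rfl
    rw [h]
    exact hk₃e.comp (hk₂e.isEmbedding.comp hk₁h.isEmbedding)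
  -- the range of `j(ℂ)` is `N₁ = g(ℂ)⁻¹ {pt ∈ O}`
  have hN₁ : Set.range jc = gc ⁻¹' {P : ComplexPoints X | P.pt ∈ O} := by
    rw [hjc]
    change Set.range (AlgPoints.map (L := ℂ) j) = _
    rw [AlgPoints.range_map_of_isOpenImmersion_holds j]
    ext z
    change z.pt ∈ W₀.ι.opensRange ↔ (AlgPoints.map g z).pt ∈ O
    rw [Scheme.Opens.opensRange_ι, AlgPoints.pt_map]
    change π.left.base z.pt ∈ (U₀ : Set X₀.toSchemeOver.left) ↔
      X₀.ι.base (π.left.base z.pt) ∈ O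
    constructor
    · intro hz
      have h' : π.left.base z.pt ∈ X₀.ι.base ⁻¹' O := by rw [hOU₀]; exact hz
      exact h'
    · intro hz
      have h' : π.left.base z.pt ∈ X₀.ι.base ⁻¹' O := hz
      rw [hOU₀] at h'
      exact h'
  constructor
  · -- embedding of `g(ℂ)` restricted to `N₁`: transport along `N₁ ≃ₜ (π⁻¹U₀)(ℂ)`
    let h₁ : ComplexPoints (openSubschemeOver Y W₀) ≃ₜ ↥(Set.range jc) := hje.isEmbedding.toHomeomorph
    let h₂ : ↥(Set.range jc) ≃ₜ ↥(gc ⁻¹' {P : ComplexPoints X | P.pt ∈ O}) := Homeomorph.setCongr hN₁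
    have hfun : (fun z : ↥(gc ⁻¹' {P : ComplexPoints X | P.pt ∈ O}) ↦ gc z) =
        (fun z ↦ gc (jc z)) ∘ (h₁.trans h₂).symm := by
      funext z
      change gc z.1 = gc (jc ((h₁.trans h₂).symm z))
      congr 1
      have e1 : ((h₁.trans h₂) ((h₁.trans h₂).symm z)).1 = z.1 := by
        rw [Homeomorph.apply_symm_apply]
      exact e1.symm
    rw [hfun]
    exact hcompe.comp (h₁.trans h₂).symm.isEmbedding
  · -- the image of `N₁` is `V(ℂ) ∩ O(ℂ)`
    rw [← hN₁, ← Set.range_comp]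
    change Set.range (fun z ↦ gc (jc z)) = _
    have h : (fun z ↦ gc (jc z)) = AlgPoints.map (L := ℂ) X₀.ιOver ∘ AlgPoints.map (L := ℂ) k₂ ∘
        AlgPoints.map (L := ℂ) k₁ := by
      funext z
      change AlgPoints.map g (AlgPoints.map j z) = _
      rw [← AlgPoints.map_comp_apply, hfac, AlgPoints.map_comp_apply, AlgPoints.map_comp_apply]
      rfl
    rw [h, Set.range_comp, Set.range_comp, hk₁h.surjective.range_eq, Set.image_univ,
      AlgPoints.range_map_of_isOpenImmersion_holds k₂]
    ext P
    constructor
    · rintro ⟨Q, hQ, rfl⟩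
      refine ⟨?_, ?_⟩
      · change (AlgPoints.map X₀.ιOver Q).pt ∈ V
        rw [AlgPoints.pt_map, ← hX₀range]
        exact ⟨Q.pt, rfl⟩
      · change (AlgPoints.map X₀.ιOver Q).pt ∈ O
        rw [AlgPoints.pt_map]
        change Q.pt ∈ U₀.ι.opensRange at hQ
        rw [Scheme.Opens.opensRange_ι] at hQ
        have : Q.pt ∈ X₀.ι.base ⁻¹' O := by rw [hOU₀]; exact hQ
        exact this
    · rintro ⟨hPV, hPO⟩
      have hPr : P ∈ Set.range (AlgPoints.map (L := ℂ) X₀.ιOver) := by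
        rw [range_map_eq_setOf_pt_mem_range]
        change P.pt ∈ Set.range X₀.ι.base
        rw [hX₀range]
        exact hPV
      obtain ⟨Q, rfl⟩ := hPr
      refine ⟨Q, ?_, rfl⟩
      change Q.pt ∈ U₀.ι.opensRange
      rw [Scheme.Opens.opensRange_ι]
      have hPO' : (AlgPoints.map X₀.ιOver Q).pt ∈ O := hPO
      have : Q.pt ∈ X₀.ι.base ⁻¹' O := by
        rw [AlgPoints.pt_map] at hPO'
        exact hPO'
      rw [hOU₀] at this
      exact this

end Summit.HodgeConjecture.HodgeConjecture.Theorems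

end
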